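import Summits.PneNP.PneNP.Theorems.ChebyshevTracialDesignDiagonalExcessTools
import Summits.PneNP.PneNP.Theorems.ChebyshevTracialDesignGammaDirectionNullTerms
import HarnessLib

/-!
# Cell pnp-psdrank, route `ChebyshevTracialDesign`: the PER-MATCHING diagonal excess of an edge class, priced CONDITIONALLY on [BULK] for the
# (full, empty) law family — brick 146a (crux `TracialDecayExp20`, stmt-PneNP-19878)

Brick 146a (engine seat g27; eng MEMO-26 §3). Lit's `ShellLawTypeSortedForms.shellForm_le_typeAvg_add` bounds the pair-containment form of an `H`-symmetric
mask in ANY direction by its value at the type-averaged direction plus `L²·Σ_a m_a·D_a`, `D_a ≥` the DIAGONAL EXCESS of the class `a`; brick 145 prices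
`Σ_M (D_a)₊` by the `r = 1` rung. Here the excess is priced PER MATCHING, summed over the ordered pairs of a representative class `R`
(`n_R(U) = #{v ∈ R : v,πv ∈ U}`; the sum is `m_a(m_a−1)·D_a(M)`). By `…DiagonalExcessTools.shellAvg_classExcess_eq` the level profile is
`(t−c)(n−t−c)·Θ̃(c) + c(t−c)·Ỹ(c−1) = t(n−t)Θ̃(c) − c·[(n−c)Θ̃(c)] + c·[(t−c)Ỹ(c−1)]` with `Θ̃(c) = (n(n−2))⁻¹Σ_{v,w} E_{Shell_{[n]∖e_v∖e_w}(t−2,c)}[ψ(X+σ)]`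
(the (full, EMPTY) pattern: an UNTILTED nonnegative block statistic one ground set down) and `Ỹ` the (full, HALF) pattern at even levels: the two
`c`-weighted terms are pure remainders (brick 119 §1 + 129a's affine Leibniz rule), the first is `−t(n−t)·N^{odd}_D[Θ̃](0)` up to the exact-design
remainder, and brick 121's criterion bounds `N^{odd}_D[Θ̃](0)` below by minus the tail of `G₂(c;x) = Σ_{v,w} law_{[n]∖e_v∖e_w}(t−2,c;x)` off any window
`B` on which `G₂` is relatively level-smooth. **`classExcess_value_le`**: for an exact design (`2D+1 ≤ T`, `T+4 ≤ t`), `M`, `H`, a class `R` of constant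
`H`-content `σ ≤ 2`, `0 ≤ ψ ≤ G`, `m ≥ 3`, `m+4(D+1)+4 ≤ n`, the `x`-smoothness families of the two patterns (`|S′|+4k+4 = n`; odd base levels / cut
`t−2−2k` and even base levels / cut `t−3−2k` = brick 129b (T9)'s family) and [BULK] for `G₂` on `B`:
`|PM|·Σ_U W(U,M)ψ(|U∩H|)·n_R(U)(|R|−n_R(U)) ≤ t(n−t)·[2^{D+1}(G/(n(n−2)))·TAIL + B_vC((T−1)/2,D+1)Gρ^{D+1}X_{D+1}] + L(K^n) + L(K^t)`,
`L(K) = (2D+1)(C(2D,D)/4^D)K_D + B_vC((T−1)/2,D+1)(T·K_{D+1} + 2(D+1)K_D)`, `K^n_k = n·Gρ^kX_k + 2k·Gρ^{k−1}X_{k−1}`, `K^t_k = t·2Gρ^kX_k + 2k·2Gρ^{k−1}X_{k−1}`.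
The discharge (146b: `levelBudget_pin2`-type budgets, a-free floor, univ tail, brick 132) and the assembly with brick 143 (146c) are NOT here; brick 145's
M-averaged route needs none of this. Nothing on `TracialDecayExp20` itself, psd rank of P_PM(K_n), or P vs NP. [cite: Rothvoss2017, §2 (PDF p. 6)]
[cite: Agarwal2000DifferenceEquations, Thm. 1.8.5 (1.8.6), Remark 1.8.1 (1.8.8)] [cite: Boole2009, Ch. II Art. 10 Ex. 3 eq. (8) (PDF pp. 34–35)]
Stature: support/instrument (kernel lane, no defs, axioms standard). Supports stmt-PneNP-19878.
-/

set_option linter.dupNamespace false -- `Summit.PneNP.PneNP.…`: summit = sub-problem (D-0017)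

noncomputable section

namespace Summit.PneNP.PneNP.Theorems.ChebyshevTracialDesignDiagonalExcessPricing

open Finset Polynomial Literature.Barriers.PneNP Literature.Combinatorics.Optimization
open Literature.Combinatorics.Optimization.ShellStep
open Summit.PneNP.PneNP.Theorems.ChebyshevTracialDesignShellOperatorForm (designValue_eq_shellAvg shell_partner_nonempty)
open Summit.PneNP.PneNP.Theorems.ChebyshevTracialDesignBlockStatisticPricing (fwdDiff_iter_one_odd rho_nonneg)
open Summit.PneNP.PneNP.Theorems.ChebyshevTracialDesignHalfPinnedNull (abs_levelSum_levelMul_le fwdDiff_iter_one_even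
  fwdDiff_iter_mul_sum)
open Summit.PneNP.PneNP.Theorems.ChebyshevTracialDesignVirtualPositivityCriterion (newtonPolyOdd_eval_zero_mixture_ge)
open Summit.PneNP.PneNP.Theorems.ChebyshevTracialDesignGammaDirectionTools (abs_fwdDiff_iter_affMul_le abs_fwdDiff_iter_pin11Profile_le)
open Summit.PneNP.PneNP.Theorems.ChebyshevTracialDesignDiagonalExcessTools (abs_fwdDiff_iter_pin10Profile_le shellAvg_classExcess_eq
  inv_mul_sum_pairs_const_le)

variable {n : ℕ}
set_option maxHeartbeats 400000 in -- the final bookkeeping identity over ~40 atoms; measured > 200k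
/-- **THE PER-MATCHING DIAGONAL EXCESS OF AN EDGE CLASS, CONDITIONAL ON [BULK] (brick 146a).** See the module docstring. [cite: Rothvoss2017, §2 (PDF p. 6)]
[cite: Agarwal2000DifferenceEquations, Thm. 1.8.5 (1.8.6), Remark 1.8.1 (1.8.8)] [cite: Boole2009, Ch. II Art. 10 Ex. 3 eq. (8) (PDF pp. 34–35)] -/
theorem classExcess_value_le {t T D : ℕ} {Bv : ℝ} {C : Finset ℕ} {w : ℕ → ℝ}
    (hdes : IsExactDesign n t T D Bv C w) (hDT : 2 * D + 1 ≤ T) (hT4 : T + 4 ≤ t) (M : PMatch n)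
    (H : Finset (Fin n)) {R : Finset (Fin n)} (hR : ∀ v ∈ R, v < M.2.partner v) {σ : ℕ} (hσ2 : σ ≤ 2)
    (hσ : ∀ v ∈ R, (({v, M.2.partner v} : Finset (Fin n)) ∩ H).card = σ)
    (ψ : ℤ → ℝ) {G : ℝ} (hG0 : 0 ≤ G) (hG : ∀ x ∈ Icc (0 : ℤ) (t : ℤ), |ψ x| ≤ G)
    (hψ0 : ∀ x ∈ Icc (0 : ℤ) (t : ℤ), 0 ≤ ψ x)
    {m : ℕ} (hm : 3 ≤ m) (hmn : m + 4 * (D + 1) + 4 ≤ n) (X : ℕ → ℝ) (hX0 : ∀ k, 0 ≤ X k)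
    (hXE : ∀ k, D ≤ k + 1 → k ≤ D + 1 → ∀ c' : ℕ, Odd c' → c' + 2 * k ≤ T →
      ∀ S' : Finset (Fin n), (∀ u ∈ S', M.2.partner u ∈ S') → S'.card + 4 * k + 4 = n →
      ∑ x ∈ Icc (0 : ℤ) ((t - 2 : ℕ) : ℤ),
        |nab2^[k] (fun c x => shellLaw M.2.partner S' H (t - 2 - 2 * k) c x : Profile) c' x| ≤ X k)
    (hXY : ∀ k, D ≤ k + 1 → k ≤ D + 1 → ∀ c' : ℕ, Even c' → c' + 2 * k + 1 ≤ T →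
      ∀ S' : Finset (Fin n), (∀ u ∈ S', M.2.partner u ∈ S') → S'.card + 4 * k + 4 = n →
      ∑ x ∈ Icc (0 : ℤ) ((t - 3 : ℕ) : ℤ),
        |nab2^[k] (fun c x => shellLaw M.2.partner S' H (t - 3 - 2 * k) c x : Profile) c' x| ≤ X k)
    (B : Finset ℤ) (hB : B ⊆ Icc (0 : ℤ) ((t - 2 : ℕ) : ℤ))
    (hbulk : ∀ x ∈ B, ∑ k ∈ Ico 1 (D + 1), (((2 * k).choose k : ℕ) : ℝ) / (4 : ℝ) ^ k *
        |(fwdDiff (1 : ℕ))^[k] (fun j => ∑ v ∈ R, ∑ w ∈ R.erase v,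
            shellLaw M.2.partner ((univ \ {v, M.2.partner v}) \ {w, M.2.partner w}) H (t - 2) (2 * j + 1) x) 0| ≤
          ∑ v ∈ R, ∑ w ∈ R.erase v,
            shellLaw M.2.partner ((univ \ {v, M.2.partner v}) \ {w, M.2.partner w}) H (t - 2) 1 x) :
    (Fintype.card (PMatch n) : ℝ) * ∑ U : OddSet n, levelWeight n t C w U M *
        (ψ ((U.1 ∩ H).card : ℤ) *
          ((((R.filter fun v => v ∈ U.1 ∧ M.2.partner v ∈ U.1).card : ℕ) : ℝ) *
            ((R.card : ℝ) - (((R.filter fun v => v ∈ U.1 ∧ M.2.partner v ∈ U.1).card : ℕ) : ℝ)))) ≤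
      (t : ℝ) * ((n : ℝ) - t) *
          ((2 : ℝ) ^ (D + 1) * (G / ((n : ℝ) * ((n : ℝ) - 2))) *
              (∑ x ∈ Icc (0 : ℤ) ((t - 2 : ℕ) : ℤ) \ B, ∑ j ∈ range (D + 1),
                ∑ v ∈ R, ∑ w ∈ R.erase v,
                  shellLaw M.2.partner ((univ \ {v, M.2.partner v}) \ {w, M.2.partner w}) H (t - 2) (2 * j + 1) x) +
            Bv * ((((T - 1) / 2).choose (D + 1) : ℕ) : ℝ) *
              (G * (((m : ℝ) / (4 * ((m : ℝ) - 2))) ^ (D + 1) * X (D + 1)))) +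
        ((2 * (D : ℝ) + 1) * ((((2 * D).choose D : ℕ) : ℝ) / (4 : ℝ) ^ D) *
            ((n : ℝ) * (G * (((m : ℝ) / (4 * ((m : ℝ) - 2))) ^ D * X D)) +
              2 * (D : ℝ) * (G * (((m : ℝ) / (4 * ((m : ℝ) - 2))) ^ (D - 1) * X (D - 1)))) +
          Bv * ((((T - 1) / 2).choose (D + 1) : ℕ) : ℝ) *
            ((T : ℝ) * ((n : ℝ) * (G * (((m : ℝ) / (4 * ((m : ℝ) - 2))) ^ (D + 1) * X (D + 1))) +
                2 * ((D : ℝ) + 1) * (G * (((m : ℝ) / (4 * ((m : ℝ) - 2))) ^ D * X D))) +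
              2 * ((D : ℝ) + 1) * ((n : ℝ) * (G * (((m : ℝ) / (4 * ((m : ℝ) - 2))) ^ D * X D)) +
                2 * (D : ℝ) * (G * (((m : ℝ) / (4 * ((m : ℝ) - 2))) ^ (D - 1) * X (D - 1)))))) +
        ((2 * (D : ℝ) + 1) * ((((2 * D).choose D : ℕ) : ℝ) / (4 : ℝ) ^ D) *
            ((t : ℝ) * (2 * (G * (((m : ℝ) / (4 * ((m : ℝ) - 2))) ^ D * X D))) +
              2 * (D : ℝ) * (2 * (G * (((m : ℝ) / (4 * ((m : ℝ) - 2))) ^ (D - 1) * X (D - 1))))) +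
          Bv * ((((T - 1) / 2).choose (D + 1) : ℕ) : ℝ) *
            ((T : ℝ) * ((t : ℝ) * (2 * (G * (((m : ℝ) / (4 * ((m : ℝ) - 2))) ^ (D + 1) * X (D + 1)))) +
                2 * ((D : ℝ) + 1) * (2 * (G * (((m : ℝ) / (4 * ((m : ℝ) - 2))) ^ D * X D)))) +
              2 * ((D : ℝ) + 1) * ((t : ℝ) * (2 * (G * (((m : ℝ) / (4 * ((m : ℝ) - 2))) ^ D * X D))) +
                2 * (D : ℝ) * (2 * (G * (((m : ℝ) / (4 * ((m : ℝ) - 2))) ^ (D - 1) * X (D - 1))))))) := by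
  classical
  obtain ⟨t₀, rfl⟩ : ∃ t₀, t = t₀ + 3 := ⟨t - 3, by omega⟩
  have h32 : t₀ + 3 - 2 = t₀ + 1 := by omega
  simp only [Nat.add_sub_cancel, h32] at hXE hXY hB hbulk ⊢
  set π := M.2.partner with hπdef
  have hπ : ∀ v, π (π v) = v := partner_partner M
  have hπ' : ∀ v, π v ≠ v := partner_ne M
  have hU : ∀ u ∈ (univ : Finset (Fin n)), π u ∈ (univ : Finset (Fin n)) := fun u _ => mem_univ _
  set ρ : ℝ := (m : ℝ) / (4 * ((m : ℝ) - 2)) with hρdef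
  have hρ0 : 0 ≤ ρ := rho_nonneg hm
  have hGXk : ∀ k, 0 ≤ G * (ρ ^ k * X k) := fun k => mul_nonneg hG0 (mul_nonneg (pow_nonneg hρ0 k) (hX0 k))
  obtain ⟨ht, h2t⟩ : Odd (t₀ + 3) ∧ 2 * (t₀ + 3) + 2 ≤ n := ⟨hdes.1, hdes.2.1⟩
  have ht1 : Odd (t₀ + 1) := by obtain ⟨i, hi⟩ := ht; exact ⟨i - 1, by omega⟩
  have hPM : (0 : ℝ) < (Fintype.card (PMatch n) : ℝ) := Nat.cast_pos.2 (Fintype.card_pos_iff.2 ⟨M⟩)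
  have hn8 : (8 : ℝ) ≤ n := by exact_mod_cast (show 8 ≤ n by omega)
  have hn0 : (0 : ℝ) < n := by linarith
  set κ₀ : ℝ := 1 / ((n : ℝ) * ((n : ℝ) - 2)) with hκ₀def
  have hκ₀0 : 0 ≤ κ₀ := by rw [hκ₀def]; exact div_nonneg zero_le_one (mul_nonneg hn0.le (by linarith))
  have hsumconst : ∀ a : ℝ, 0 ≤ a → κ₀ * ∑ v ∈ R, ∑ w ∈ R.erase v, a ≤ a := fun a ha => by
    rw [hκ₀def]; exact inv_mul_sum_pairs_const_le M hR (by omega) ha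
  have hσr : (σ : ℤ) ≤ 2 := by exact_mod_cast hσ2
  have hGσ1 : ∀ x ∈ Icc (0 : ℤ) ((t₀ + 1 : ℕ) : ℤ), |ψ (x + σ)| ≤ G := by
    intro x hx; rw [mem_Icc] at hx; refine hG _ (mem_Icc.2 ⟨by linarith [hx.1], ?_⟩); push_cast at hx ⊢; linarith [hx.2]
  have hGσh : ∀ hh : ℤ, 0 ≤ hh → hh ≤ 1 → ∀ x ∈ Icc (0 : ℤ) ((t₀ : ℕ) : ℤ), |ψ (x + σ + hh)| ≤ G := by
    intro hh h0 h1 x hx; rw [mem_Icc] at hx; refine hG _ (mem_Icc.2 ⟨by linarith [hx.1], ?_⟩); push_cast at hx ⊢; linarith [hx.2]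
  set E2 : Fin n → Fin n → ℕ → ℝ := fun v w c =>
    (∑ W ∈ shellIn π ((univ \ {v, π v}) \ {w, π w}) (t₀ + 1) c, ψ (((W ∩ H).card : ℤ) + (σ : ℤ))) /
      ((shellIn π ((univ \ {v, π v}) \ {w, π w}) (t₀ + 1) c).card : ℝ) with hE2
  set Y2 : Fin n → Fin n → ℕ → ℝ := fun v w c =>
    (∑ W ∈ shellIn π ((univ \ {v, π v}) \ {w, π w}) t₀ c, ψ (((W ∩ H).card : ℤ) + (σ : ℤ) + (if w ∈ H then 1 else 0))) /
        ((shellIn π ((univ \ {v, π v}) \ {w, π w}) t₀ c).card : ℝ) +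
      (∑ W ∈ shellIn π ((univ \ {v, π v}) \ {w, π w}) t₀ c, ψ (((W ∩ H).card : ℤ) + (σ : ℤ) + (if π w ∈ H then 1 else 0))) /
        ((shellIn π ((univ \ {v, π v}) \ {w, π w}) t₀ c).card : ℝ) with hY2
  set Θt : ℕ → ℝ := fun c => κ₀ * ∑ v ∈ R, ∑ w ∈ R.erase v, E2 v w c with hΘt
  set Yt : ℕ → ℝ := fun c => κ₀ * ∑ v ∈ R, ∑ w ∈ R.erase v, Y2 v w c with hYt
  set θE : ℕ → ℝ := fun c => ((n : ℝ) - c) * Θt c with hθE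
  set θY : ℕ → ℝ := fun c => ((t₀ : ℝ) + 3 - c) * Yt (c - 1) with hθY
  have hval : (Fintype.card (PMatch n) : ℝ) * ∑ U : OddSet n, levelWeight n (t₀ + 3) C w U M *
      (ψ ((U.1 ∩ H).card : ℤ) *
        ((((R.filter fun v => v ∈ U.1 ∧ π v ∈ U.1).card : ℕ) : ℝ) *
          ((R.card : ℝ) - (((R.filter fun v => v ∈ U.1 ∧ π v ∈ U.1).card : ℕ) : ℝ)))) =
      ((t₀ : ℝ) + 3) * ((n : ℝ) - (t₀ + 3)) * ∑ c ∈ C, w c * Θt c - ∑ c ∈ C, w c * ((c : ℝ) * θE c) +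
        ∑ c ∈ C, w c * ((c : ℝ) * θY c) := by
    rw [designValue_eq_shellAvg (t₀ + 3) ht C w M (fun U₁ => ψ ((U₁ ∩ H).card : ℤ) *
        ((((R.filter fun v => v ∈ U₁ ∧ π v ∈ U₁).card : ℕ) : ℝ) *
          ((R.card : ℝ) - (((R.filter fun v => v ∈ U₁ ∧ π v ∈ U₁).card : ℕ) : ℝ)))),
      ← mul_assoc, mul_inv_cancel₀ hPM.ne', one_mul]
    have hRHS : ((t₀ : ℝ) + 3) * ((n : ℝ) - (t₀ + 3)) * ∑ c ∈ C, w c * Θt c - ∑ c ∈ C, w c * ((c : ℝ) * θE c) +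
        ∑ c ∈ C, w c * ((c : ℝ) * θY c) =
        ∑ c ∈ C, w c * (((t₀ : ℝ) + 3) * ((n : ℝ) - (t₀ + 3)) * Θt c - (c : ℝ) * θE c + (c : ℝ) * θY c) := by
      rw [mul_sum, ← sum_sub_distrib, ← sum_add_distrib]
      exact sum_congr rfl fun c _ => by ring
    rw [hRHS]
    refine sum_congr rfl fun c hc => ?_
    obtain ⟨hcodd, h3c, hcT, -⟩ := hdes.2.2.2.1 c hc
    obtain ⟨c₀, rfl⟩ : ∃ c₀, c = c₀ + 1 := ⟨c - 1, by omega⟩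
    congr 1
    rw [shellAvg_classExcess_eq M H hR ψ ht hcodd (by omega) (by omega)]
    have eE : ∑ v ∈ R, ∑ w ∈ R.erase v,
        (∑ W ∈ shellIn π ((univ \ {v, π v}) \ {w, π w}) (t₀ + 1) (c₀ + 1),
            ψ (((W ∩ H).card : ℤ) + ((({v, π v} : Finset (Fin n)) ∩ H).card : ℤ))) /
          ((shellIn π ((univ \ {v, π v}) \ {w, π w}) (t₀ + 1) (c₀ + 1)).card : ℝ) =
        ∑ v ∈ R, ∑ w ∈ R.erase v, E2 v w (c₀ + 1) := by
      refine sum_congr rfl fun v hv => sum_congr rfl fun w _ => ?_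
      rw [hE2, hσ v hv]
    have eY : ∑ v ∈ R, ∑ w ∈ R.erase v,
        ((∑ W ∈ shellIn π ((univ \ {v, π v}) \ {w, π w}) t₀ c₀,
            ψ (((W ∩ H).card : ℤ) + ((({v, π v} : Finset (Fin n)) ∩ H).card : ℤ) + (if w ∈ H then 1 else 0))) /
            ((shellIn π ((univ \ {v, π v}) \ {w, π w}) t₀ c₀).card : ℝ) +
          (∑ W ∈ shellIn π ((univ \ {v, π v}) \ {w, π w}) t₀ c₀,
            ψ (((W ∩ H).card : ℤ) + ((({v, π v} : Finset (Fin n)) ∩ H).card : ℤ) + (if π w ∈ H then 1 else 0))) /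
            ((shellIn π ((univ \ {v, π v}) \ {w, π w}) t₀ c₀).card : ℝ)) =
        ∑ v ∈ R, ∑ w ∈ R.erase v, Y2 v w c₀ := by
      refine sum_congr rfl fun v hv => sum_congr rfl fun w _ => ?_
      rw [hY2, hσ v hv]
    rw [eE, eY]
    simp only [hθE, hθY, hΘt, hYt, hκ₀def, Nat.add_sub_cancel]
    field_simp
    push_cast
    ring
  rw [hval]
  have hKΘ : ∀ k, D ≤ k + 1 → k ≤ D + 1 → ∀ y : ℕ, 2 * (y + k) + 1 ≤ T →
      |((fwdDiff (1 : ℕ))^[k] (fun j => Θt (2 * j + 1))) y| ≤ G * (ρ ^ k * X k) := by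
    intro k hDk hkD y hy
    have hGX := hGXk k
    have hfun : (fun j => Θt (2 * j + 1)) = fun j => κ₀ * ∑ v ∈ R, (fun v j => ∑ w ∈ R.erase v, E2 v w (2 * j + 1)) v j := by
      funext j; rw [hΘt]
    rw [hfun, fwdDiff_iter_mul_sum, abs_mul, abs_of_nonneg hκ₀0]
    have hsplit : t₀ + 1 = (t₀ + 1 - 2 * k) + 2 * k := by omega
    have hinner : ∀ v ∈ R, |(fwdDiff (1 : ℕ))^[k] (fun j => ∑ w ∈ R.erase v, E2 v w (2 * j + 1)) y| ≤
        ∑ w ∈ R.erase v, G * (ρ ^ k * X k) := by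
      intro v hv
      have hfun2 : (fun j => ∑ w ∈ R.erase v, E2 v w (2 * j + 1)) =
          fun j => (1 : ℝ) * ∑ w ∈ R.erase v, (fun w j => E2 v w (2 * j + 1)) w j := by
        funext j; rw [one_mul]
      rw [hfun2, fwdDiff_iter_mul_sum, one_mul]
      refine (abs_sum_le_sum_abs _ _).trans (sum_le_sum fun w' hw' => ?_)
      have hw'R : w' ∈ R := (mem_erase.1 hw').2
      obtain ⟨h1, h2, -, -⟩ := reps_edges_disjoint hπ (hR v hv) (hR w' hw'R) (mem_erase.1 hw').1
      rw [fwdDiff_iter_one_odd, hE2]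
      simp only
      rw [hsplit]
      refine abs_fwdDiff_iter_pin10Profile_le M h1 h2 H (fun x => ψ (x + σ)) hG0 (by rw [← hsplit]; exact hGσ1)
        (by rw [← hsplit]; exact ht1) ⟨y, by ring⟩ (by omega) (by omega) hm (by omega) (hX0 k) ?_
      intro S' hS' hcard
      have := hXE k hDk hkD (2 * y + 1) ⟨y, by ring⟩ (by omega) S' hS' hcard
      rw [← hsplit]
      convert this using 4
    calc κ₀ * |∑ v ∈ R, (fwdDiff (1 : ℕ))^[k] (fun j => ∑ w ∈ R.erase v, E2 v w (2 * j + 1)) y|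
        ≤ κ₀ * ∑ v ∈ R, ∑ w ∈ R.erase v, G * (ρ ^ k * X k) :=
          mul_le_mul_of_nonneg_left ((abs_sum_le_sum_abs _ _).trans (sum_le_sum hinner)) hκ₀0
      _ ≤ G * (ρ ^ k * X k) := hsumconst _ hGX
  have hKY : ∀ k, D ≤ k + 1 → k ≤ D + 1 → ∀ y : ℕ, 2 * (y + k) + 1 ≤ T →
      |((fwdDiff (1 : ℕ))^[k] (fun y => Yt (2 * y))) y| ≤ 2 * (G * (ρ ^ k * X k)) := by
    intro k hDk hkD y hy
    have hGX := hGXk k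
    have hfun : (fun y => Yt (2 * y)) = fun y => κ₀ * ∑ v ∈ R, (fun v y => ∑ w ∈ R.erase v, Y2 v w (2 * y)) v y := by
      funext y; rw [hYt]
    rw [hfun, fwdDiff_iter_mul_sum, abs_mul, abs_of_nonneg hκ₀0]
    have hsplit : t₀ = (t₀ - 2 * k) + 2 * k := by omega
    have hinner : ∀ v ∈ R, |(fwdDiff (1 : ℕ))^[k] (fun y => ∑ w ∈ R.erase v, Y2 v w (2 * y)) y| ≤
        ∑ w ∈ R.erase v, 2 * (G * (ρ ^ k * X k)) := by
      intro v hv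
      have hfun2 : (fun y => ∑ w ∈ R.erase v, Y2 v w (2 * y)) =
          fun y => (1 : ℝ) * ∑ w ∈ R.erase v, (fun w y => Y2 v w (2 * y)) w y := by
        funext y; rw [one_mul]
      rw [hfun2, fwdDiff_iter_mul_sum, one_mul]
      refine (abs_sum_le_sum_abs _ _).trans (sum_le_sum fun w' hw' => ?_)
      have hw'R : w' ∈ R := (mem_erase.1 hw').2
      obtain ⟨h1, h2, -, -⟩ := reps_edges_disjoint hπ (hR v hv) (hR w' hw'R) (mem_erase.1 hw').1
      have hw'1 : w' ∈ (univ : Finset (Fin n)) \ {v, π v} := by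
        rw [mem_sdiff, mem_insert, mem_singleton, not_or]; exact ⟨mem_univ _, h1, h2⟩
      have hY2split : (fun y => Y2 v w' (2 * y)) =
          (fun y => (∑ W ∈ shellIn π ((univ \ {v, π v}) \ {w', π w'}) t₀ (2 * y),
              ψ (((W ∩ H).card : ℤ) + (σ : ℤ) + (if w' ∈ H then 1 else 0))) /
              ((shellIn π ((univ \ {v, π v}) \ {w', π w'}) t₀ (2 * y)).card : ℝ)) +
          (fun y => (∑ W ∈ shellIn π ((univ \ {v, π v}) \ {w', π w'}) t₀ (2 * y),
              ψ (((W ∩ H).card : ℤ) + (σ : ℤ) + (if π w' ∈ H then 1 else 0))) /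
              ((shellIn π ((univ \ {v, π v}) \ {w', π w'}) t₀ (2 * y)).card : ℝ)) := by
        funext y; rw [hY2]; rfl
      rw [hY2split, fwdDiff_iter_add, Pi.add_apply]
      refine (abs_add_le _ _).trans ?_
      have hone : ∀ hh : ℤ, 0 ≤ hh → hh ≤ 1 →
          |(fwdDiff (1 : ℕ))^[k] (fun y => (∑ W ∈ shellIn π ((univ \ {v, π v}) \ {w', π w'}) t₀ (2 * y),
              ψ (((W ∩ H).card : ℤ) + (σ : ℤ) + hh)) /
              ((shellIn π ((univ \ {v, π v}) \ {w', π w'}) t₀ (2 * y)).card : ℝ)) y| ≤ G * (ρ ^ k * X k) := by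
        intro hh hh0 hh1
        set φh : ℕ → ℝ := fun c => (∑ W ∈ shellIn π ((univ \ {v, π v}) \ {w', π w'}) t₀ c,
            ψ (((W ∩ H).card : ℤ) + (σ : ℤ) + hh)) / ((shellIn π ((univ \ {v, π v}) \ {w', π w'}) t₀ c).card : ℝ) with hφh
        have hfunφ : (fun y => (∑ W ∈ shellIn π ((univ \ {v, π v}) \ {w', π w'}) t₀ (2 * y),
              ψ (((W ∩ H).card : ℤ) + (σ : ℤ) + hh)) /
              ((shellIn π ((univ \ {v, π v}) \ {w', π w'}) t₀ (2 * y)).card : ℝ)) = fun y => φh (2 * y) := by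
          funext y; rw [hφh]
        rw [hfunφ, fwdDiff_iter_one_even, hφh]
        rw [hsplit]
        refine abs_fwdDiff_iter_pin11Profile_le M hw'1 H (fun x => ψ (x + σ + hh)) hG0
          (by rw [← hsplit]; exact hGσh hh hh0 hh1) (by rw [← hsplit]; exact ht) ⟨y, by ring⟩ (by omega) (by omega) hm
          (by omega) (hX0 k) ?_
        intro S' hS' hcard
        have := hXY k hDk hkD (2 * y) ⟨y, by ring⟩ (by omega) S' hS' hcard
        rw [← hsplit]
        convert this using 4
      have hA := hone (if w' ∈ H then 1 else 0) (by split_ifs <;> norm_num) (by split_ifs <;> norm_num)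
      have hB' := hone (if π w' ∈ H then 1 else 0) (by split_ifs <;> norm_num) (by split_ifs <;> norm_num)
      linarith
    calc κ₀ * |∑ v ∈ R, (fwdDiff (1 : ℕ))^[k] (fun y => ∑ w ∈ R.erase v, Y2 v w (2 * y)) y|
        ≤ κ₀ * ∑ v ∈ R, ∑ w ∈ R.erase v, 2 * (G * (ρ ^ k * X k)) :=
          mul_le_mul_of_nonneg_left ((abs_sum_le_sum_abs _ _).trans (sum_le_sum hinner)) hκ₀0
      _ ≤ 2 * (G * (ρ ^ k * X k)) := hsumconst _ (by positivity)
  have hθEodd : (fun y : ℕ => θE (2 * y + 1)) = fun y : ℕ => (((n : ℝ) - 1) - 2 * (y : ℝ)) * (fun j => Θt (2 * j + 1)) y := by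
    funext y
    simp only [hθE]
    push_cast
    ring
  have hKE : ∀ k, D ≤ k → k ≤ D + 1 → ∀ y : ℕ, 2 * (y + k) + 1 ≤ T →
      |((fwdDiff (1 : ℕ))^[k] (fun y => θE (2 * y + 1))) y| ≤
        (n : ℝ) * (G * (ρ ^ k * X k)) + 2 * (k : ℝ) * (G * (ρ ^ (k - 1) * X (k - 1))) := by
    intro k hDk hkD y hy
    rw [hθEodd]
    have hyT : 2 * (y : ℝ) ≤ (n : ℝ) - 1 := by
      have : 2 * y + 1 ≤ n := by omega
      have : 2 * (y : ℝ) + 1 ≤ n := by exact_mod_cast this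
      linarith
    have hy0 : (0 : ℝ) ≤ y := Nat.cast_nonneg _
    have hA : |((n : ℝ) - 1) - 2 * (y : ℝ)| ≤ (n : ℝ) := by
      rw [abs_le]; constructor <;> linarith
    refine (abs_fwdDiff_iter_affMul_le (fun j => Θt (2 * j + 1)) k y hA).trans ?_
    have h1 := hKΘ k (by omega) hkD y hy
    have h2 : 2 * (k : ℝ) * |(fwdDiff (1 : ℕ))^[k - 1] (fun j => Θt (2 * j + 1)) (y + 1)| ≤
        2 * (k : ℝ) * (G * (ρ ^ (k - 1) * X (k - 1))) := by
      rcases Nat.eq_zero_or_pos k with hk0 | hkpos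
      · subst hk0; simp
      · exact mul_le_mul_of_nonneg_left (hKΘ (k - 1) (by omega) (by omega) (y + 1) (by omega)) (by positivity)
    exact add_le_add (mul_le_mul_of_nonneg_left h1 (by positivity)) h2
  have hθYodd : (fun y : ℕ => θY (2 * y + 1)) = fun y : ℕ => (((t₀ : ℝ) + 2) - 2 * (y : ℝ)) * (fun y => Yt (2 * y)) y := by
    funext y
    simp only [hθY, Nat.add_sub_cancel]
    push_cast
    ring
  have hKYw : ∀ k, D ≤ k → k ≤ D + 1 → ∀ y : ℕ, 2 * (y + k) + 1 ≤ T →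
      |((fwdDiff (1 : ℕ))^[k] (fun y => θY (2 * y + 1))) y| ≤
        ((t₀ : ℝ) + 3) * (2 * (G * (ρ ^ k * X k))) + 2 * (k : ℝ) * (2 * (G * (ρ ^ (k - 1) * X (k - 1)))) := by
    intro k hDk hkD y hy
    rw [hθYodd]
    have hyT : 2 * (y : ℝ) ≤ (t₀ : ℝ) + 2 := by exact_mod_cast (show 2 * y ≤ t₀ + 2 by omega)
    have hy0 : (0 : ℝ) ≤ y := Nat.cast_nonneg _
    have hA : |((t₀ : ℝ) + 2) - 2 * (y : ℝ)| ≤ (t₀ : ℝ) + 3 := by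
      rw [abs_le]; constructor <;> linarith
    refine (abs_fwdDiff_iter_affMul_le (fun y => Yt (2 * y)) k y hA).trans ?_
    have h1 := hKY k (by omega) hkD y hy
    have h2 : 2 * (k : ℝ) * |(fwdDiff (1 : ℕ))^[k - 1] (fun y => Yt (2 * y)) (y + 1)| ≤
        2 * (k : ℝ) * (2 * (G * (ρ ^ (k - 1) * X (k - 1)))) := by
      rcases Nat.eq_zero_or_pos k with hk0 | hkpos
      · subst hk0; simp
      · exact mul_le_mul_of_nonneg_left (hKY (k - 1) (by omega) (by omega) (y + 1) (by omega)) (by positivity)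
    exact add_le_add (mul_le_mul_of_nonneg_left h1 (by positivity)) h2
  have hKE0 : ∀ k, 0 ≤ (n : ℝ) * (G * (ρ ^ k * X k)) + 2 * (k : ℝ) * (G * (ρ ^ (k - 1) * X (k - 1))) :=
    fun k => add_nonneg (mul_nonneg hn0.le (hGXk _)) (mul_nonneg (by positivity) (hGXk _))
  have hKY0 : ∀ k, 0 ≤ ((t₀ : ℝ) + 3) * (2 * (G * (ρ ^ k * X k))) + 2 * (k : ℝ) * (2 * (G * (ρ ^ (k - 1) * X (k - 1)))) :=
    fun k => add_nonneg (mul_nonneg (by positivity) (by linarith [hGXk k])) (mul_nonneg (by positivity) (by linarith [hGXk (k - 1)]))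
  have hKE1 : ∀ y : ℕ, 2 * (y + (D + 1)) + 1 ≤ T →
      |((fwdDiff (1 : ℕ))^[D + 1] (fun y => θE (2 * y + 1))) y| ≤
        (n : ℝ) * (G * (ρ ^ (D + 1) * X (D + 1))) + 2 * ((D : ℝ) + 1) * (G * (ρ ^ D * X D)) := by
    intro y hy
    have h := hKE (D + 1) (by omega) le_rfl y hy
    simp only [Nat.add_sub_cancel] at h
    push_cast at h
    exact h
  have hKY1 : ∀ y : ℕ, 2 * (y + (D + 1)) + 1 ≤ T →
      |((fwdDiff (1 : ℕ))^[D + 1] (fun y => θY (2 * y + 1))) y| ≤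
        ((t₀ : ℝ) + 3) * (2 * (G * (ρ ^ (D + 1) * X (D + 1)))) + 2 * ((D : ℝ) + 1) * (2 * (G * (ρ ^ D * X D))) := by
    intro y hy
    have h := hKYw (D + 1) (by omega) le_rfl y hy
    simp only [Nat.add_sub_cancel] at h
    push_cast at h
    exact h
  have hKE10 : 0 ≤ (n : ℝ) * (G * (ρ ^ (D + 1) * X (D + 1))) + 2 * ((D : ℝ) + 1) * (G * (ρ ^ D * X D)) :=
    add_nonneg (mul_nonneg hn0.le (hGXk _)) (mul_nonneg (by positivity) (hGXk _))
  have hKY10 : 0 ≤ ((t₀ : ℝ) + 3) * (2 * (G * (ρ ^ (D + 1) * X (D + 1)))) + 2 * ((D : ℝ) + 1) * (2 * (G * (ρ ^ D * X D))) :=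
    add_nonneg (mul_nonneg (by positivity) (by linarith [hGXk (D + 1)])) (mul_nonneg (by positivity) (by linarith [hGXk D]))
  have hremE := abs_levelSum_levelMul_le hdes.exact hdes.variation_le hdes.level_le (fun c hc => (hdes.2.2.2.1 c hc).1) hDT θE
    (hKE0 D) hKE10 (fun j hj => hKE D le_rfl (by omega) j hj) hKE1
  have hremY := abs_levelSum_levelMul_le hdes.exact hdes.variation_le hdes.level_le (fun c hc => (hdes.2.2.2.1 c hc).1) hDT θY
    (hKY0 D) hKY10 (fun j hj => hKYw D le_rfl (by omega) j hj) hKY1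
  have hmain := hdes.abs_levelSum_add_le_of_fwdDiff_odd Θt (mul_nonneg hG0 (mul_nonneg (pow_nonneg hρ0 (D + 1)) (hX0 (D + 1))))
    (fun j hj => hKΘ (D + 1) (by omega) le_rfl j hj)
  have hΘmix : Θt = fun c => ∑ x ∈ Icc (0 : ℤ) ((t₀ + 1 : ℕ) : ℤ), (κ₀ * ψ (x + σ)) *
      ∑ v ∈ R, ∑ w ∈ R.erase v, shellLaw π ((univ \ {v, π v}) \ {w, π w}) H (t₀ + 1) c x := by
    funext c
    rw [hΘt]
    simp only [hE2]
    have e : ∀ v w : Fin n, (∑ W ∈ shellIn π ((univ \ {v, π v}) \ {w, π w}) (t₀ + 1) c, ψ (((W ∩ H).card : ℤ) + (σ : ℤ))) /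
        ((shellIn π ((univ \ {v, π v}) \ {w, π w}) (t₀ + 1) c).card : ℝ) =
        ∑ x ∈ Icc (0 : ℤ) ((t₀ + 1 : ℕ) : ℤ), ψ (x + σ) * shellLaw π ((univ \ {v, π v}) \ {w, π w}) H (t₀ + 1) c x :=
      fun v w => shellInAvg_eq_sum_mul_shellLaw _ H (t₀ + 1) c (fun x => ψ (x + σ))
    simp only [e]
    have hcomm : ∑ v ∈ R, ∑ w ∈ R.erase v, ∑ x ∈ Icc (0 : ℤ) ((t₀ + 1 : ℕ) : ℤ),
        ψ (x + σ) * shellLaw π ((univ \ {v, π v}) \ {w, π w}) H (t₀ + 1) c x =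
        ∑ x ∈ Icc (0 : ℤ) ((t₀ + 1 : ℕ) : ℤ), ∑ v ∈ R, ∑ w ∈ R.erase v,
          ψ (x + σ) * shellLaw π ((univ \ {v, π v}) \ {w, π w}) H (t₀ + 1) c x := by
      rw [sum_comm]
      exact sum_congr rfl fun v _ => sum_comm
    rw [hcomm, mul_sum]
    refine sum_congr rfl fun x _ => ?_
    rw [mul_sum, mul_sum]
    refine sum_congr rfl fun v _ => ?_
    rw [mul_sum, mul_sum]
    exact sum_congr rfl fun w _ => by ring
  have hcrit := newtonPolyOdd_eval_zero_mixture_ge D (Icc (0 : ℤ) ((t₀ + 1 : ℕ) : ℤ)) B hB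
    (fun c x => ∑ v ∈ R, ∑ w ∈ R.erase v, shellLaw π ((univ \ {v, π v}) \ {w, π w}) H (t₀ + 1) c x)
    (fun c x => sum_nonneg fun v _ => sum_nonneg fun w _ => by rw [shellLaw, shellCount]; positivity)
    (fun x => κ₀ * ψ (x + σ)) (G := κ₀ * G)
    (fun x hx => mul_nonneg hκ₀0 (hψ0 _ (by
      rw [mem_Icc] at hx ⊢; constructor
      · linarith [hx.1]
      · have := hx.2; push_cast at this ⊢; linarith)))
    (fun x hx => mul_le_mul_of_nonneg_left ((le_abs_self _).trans (hGσ1 x hx)) hκ₀0) hbulk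
  rw [← hΘmix] at hcrit
  have httn : 0 ≤ ((t₀ : ℝ) + 3) * ((n : ℝ) - (t₀ + 3)) := by
    refine mul_nonneg (by positivity) ?_
    have : ((2 * (t₀ + 3) + 2 : ℕ) : ℝ) ≤ n := by exact_mod_cast h2t
    push_cast at this; linarith
  have hmain' : ∑ c ∈ C, w c * Θt c ≤
      (2 : ℝ) ^ (D + 1) * (κ₀ * G) * (∑ x ∈ Icc (0 : ℤ) ((t₀ + 1 : ℕ) : ℤ) \ B, ∑ j ∈ range (D + 1),
          ∑ v ∈ R, ∑ w ∈ R.erase v, shellLaw π ((univ \ {v, π v}) \ {w, π w}) H (t₀ + 1) (2 * j + 1) x) +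
        Bv * ((((T - 1) / 2).choose (D + 1) : ℕ) : ℝ) * (G * (ρ ^ (D + 1) * X (D + 1))) := by
    have h1 := (abs_le.1 hmain).2
    linarith
  have hκG : κ₀ * G = G / ((n : ℝ) * ((n : ℝ) - 2)) := by rw [hκ₀def]; ring
  rw [hκG] at hmain'
  have hA1 := mul_le_mul_of_nonneg_left hmain' httn
  have hE' := (neg_le_abs _).trans hremE
  have hY' := (le_abs_self _).trans hremY
  have hfin := add_le_add (add_le_add hA1 hE') hY'
  refine (le_of_eq (by ring)).trans (hfin.trans (le_of_eq ?_))
  simp only [hρdef]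
  push_cast
  ring

end Summit.PneNP.PneNP.Theorems.ChebyshevTracialDesignDiagonalExcessPricing

end
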